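import Mathlib
import Summits.ABC.ABC.Theses.IneffectiveSubspace

/-!
# Stub `stub_ulGivesUBQ` of line `SketchIdeator5` (idea `cm-hall-lang-transfer`) — crux `IneffectiveSubspace.TowerFourSubLiouville` (stmt-ABC-1649)

UNIFORM LJUNGGREN ⟹ a uniform power saving for the binomial quartic family.

Hypothesis (uniform Ljunggren): there are `K, C` with `C > 0` such that every integer solution of
`x² − d·y⁴ = k` with `d` not a square and `k ≠ 0` has `|y| ≤ C·(|d|·|k|)^K`.
Conclusion: for `η := 1/(1 + 16·max K 0)` and `Z₀ > 2C⁴`, `Z₀ ≥ 2`, every `(v, w, Y, Z)` with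
`Z ≥ Z₀`, `v, w, Y > 0`, `gcd(vY, wZ) = 1`, `max(v, w) ≤ Z^η`, `wZ⁴ ≠ vY⁴` has `|wZ⁴ − vY⁴| > Z^η`.

Proof. Suppose `D := wZ⁴ − vY⁴` has `|D| ≤ Z^η` (so `1 ≤ |D| ≤ Z^η ≤ Z`). `gcd(v, w) = 1`.
* If `vw` is a square then `v = s²`, `w = t²` (coprime factors of a square), and
  `D = (tZ² − sY²)(tZ² + sY²)` with the first factor a nonzero integer, so
  `|D| ≥ tZ² + sY² ≥ Z² + 1 > Z ≥ Z^η`.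
* Otherwise `d := vw` is not a square and `(x, y, k) := (wZ², Y, wD)` solves `x² − d y⁴ = k ≠ 0`, so
  `Y ≤ C·(vw·w|D|)^K ≤ C·Z^{4ηK₁}` (`K₁ = max K 0`, each of `v, w, |D|` is in `[1, Z^η]`), whence
  `Z⁴ − Z ≤ wZ⁴ − D = vY⁴ ≤ Z^η·C⁴·Z^{16ηK₁} = C⁴·Z` (as `η(1 + 16K₁) = 1`), i.e. `Z³ ≤ C⁴ + 1`,
  impossible for `Z ≥ 2`, `Z > 2C⁴`.
-/

-- `Summit.ABC.ABC` is the mandated summit-side namespace (CONVENTIONS §2); the duplicate is deliberate.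
set_option linter.dupNamespace false

namespace Summit.ABC.ABC.Theorems.TowerFourSubLiouville

/-- Coprime factors of a square (in `ℕ`) are squares. -/
theorem ulGivesUBQ_isSquare_of_coprime {m n : ℕ} (hmn : m.Coprime n) (h : IsSquare (m * n)) :
    IsSquare m ∧ IsSquare n := by
  obtain ⟨r, hr⟩ := h
  have hu : IsUnit (gcd m n) := by
    rw [Nat.isUnit_iff]
    exact hmn
  have hu' : IsUnit (gcd n m) := by
    rw [Nat.isUnit_iff]
    exact hmn.symm
  have hr2 : m * n = r ^ 2 := by rw [hr, sq]
  have hr2' : n * m = r ^ 2 := by rw [mul_comm, hr2]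
  obtain ⟨d, hd⟩ := exists_eq_pow_of_mul_eq_pow hu hr2
  obtain ⟨e, he⟩ := exists_eq_pow_of_mul_eq_pow hu' hr2'
  exact ⟨⟨d, by rw [hd, sq]⟩, ⟨e, by rw [he, sq]⟩⟩

/-- The square corner: for `s, t, Y > 0`, a nonzero `t²Z⁴ − s²Y⁴ = (tZ² − sY²)(tZ² + sY²)` has
absolute value at least `Z² + 1`. -/
theorem ulGivesUBQ_square_corner (s t Y Z : ℤ) (hs : 0 < s) (ht : 0 < t) (hY : 0 < Y)
    (hne : t * t * Z ^ 4 - s * s * Y ^ 4 ≠ 0) :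
    Z ^ 2 + 1 ≤ |t * t * Z ^ 4 - s * s * Y ^ 4| := by
  have hfac :
      t * t * Z ^ 4 - s * s * Y ^ 4 = (t * Z ^ 2 - s * Y ^ 2) * (t * Z ^ 2 + s * Y ^ 2) := by
    ring
  have h1 : t * Z ^ 2 - s * Y ^ 2 ≠ 0 := by
    intro h
    apply hne
    rw [hfac, h, zero_mul]
  have h1' : 1 ≤ |t * Z ^ 2 - s * Y ^ 2| := Int.one_le_abs h1
  have hZ2 : 0 ≤ Z ^ 2 := sq_nonneg Z
  have hY2 : 1 ≤ Y ^ 2 := by nlinarith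
  have hpos : 0 < t * Z ^ 2 + s * Y ^ 2 := by nlinarith
  have h2 : Z ^ 2 + 1 ≤ t * Z ^ 2 + s * Y ^ 2 := by nlinarith
  rw [hfac, abs_mul]
  calc Z ^ 2 + 1 ≤ t * Z ^ 2 + s * Y ^ 2 := h2
    _ = 1 * |t * Z ^ 2 + s * Y ^ 2| := by rw [abs_of_pos hpos, one_mul]
    _ ≤ |t * Z ^ 2 - s * Y ^ 2| * |t * Z ^ 2 + s * Y ^ 2| :=
        mul_le_mul_of_nonneg_right h1' (abs_nonneg _)

/-- The final numerical contradiction: `Z ≥ 2`, `Z > 2c` and `Z⁴ − Z ≤ P ≤ c·Z` are incompatible. -/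
theorem ulGivesUBQ_absurd {Z c P : ℝ} (hZ2 : 2 ≤ Z) (hcZ : 2 * c < Z) (hlow : Z ^ 4 - Z ≤ P)
    (hup : P ≤ c * Z) : False := by
  have hZ0 : 0 < Z := by linarith
  have hmul : 2 * c * Z < Z * Z := mul_lt_mul_of_pos_right hcZ hZ0
  have hZZ : 2 * Z ≤ Z ^ 2 := by nlinarith
  have hZsq4 : 4 ≤ Z ^ 2 := by nlinarith
  have hZ4 : 4 * Z ^ 2 ≤ Z ^ 4 := by nlinarith [mul_le_mul_of_nonneg_right hZsq4 (sq_nonneg Z)]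
  linarith

/-- **Uniform Ljunggren ⟹ uniform binomial-quartic saving** (curried form). -/
theorem ulGivesUBQ_core {K C : ℝ} (hC : 0 < C)
    (hUL : ∀ d k x y : ℤ, ¬ IsSquare d → k ≠ 0 → x ^ 2 - d * y ^ 4 = k →
      (|y| : ℝ) ≤ C * ((|d| * |k| : ℤ) : ℝ) ^ K) :
    ∃ η : ℝ, 0 < η ∧ ∃ Z₀ : ℕ, ∀ v w Y Z : ℕ, Z₀ ≤ Z → 0 < v → 0 < w → 0 < Y →
      Nat.Coprime (v * Y) (w * Z) → ((max v w : ℕ) : ℝ) ≤ (Z : ℝ) ^ η → w * Z ^ 4 ≠ v * Y ^ 4 →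
      (Z : ℝ) ^ η < |((w * Z ^ 4 : ℕ) : ℝ) - ((v * Y ^ 4 : ℕ) : ℝ)| := by
  -- the exponent `η = 1/(1 + 16 K₁)`, `K₁ = max K 0`
  obtain ⟨K₁, hK₁0, hKK₁⟩ : ∃ K₁ : ℝ, 0 ≤ K₁ ∧ K ≤ K₁ :=
    ⟨max K 0, le_max_right _ _, le_max_left _ _⟩
  have hden : (0 : ℝ) < 1 + 16 * K₁ := by positivity
  obtain ⟨η, hη⟩ : ∃ η : ℝ, η = 1 / (1 + 16 * K₁) := ⟨_, rfl⟩
  have hη0 : 0 < η := by rw [hη]; positivity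
  have hη1 : η ≤ 1 := by
    rw [hη, div_le_one hden]
    linarith
  have hηK : η * (1 + 16 * K₁) = 1 := by
    rw [hη]
    field_simp
  -- the threshold `Z₀ = max N 2`, `N > 2 C⁴`
  obtain ⟨N, hN⟩ := exists_nat_gt (2 * C ^ 4)
  refine ⟨η, hη0, max N 2, ?_⟩
  intro v w Y Z hZ hv hw hY hcop hmax hne
  by_contra hcon
  rw [not_lt] at hcon
  -- basic sizes
  have hZ2 : 2 ≤ Z := le_trans (le_max_right _ _) hZ
  have hNZ : N ≤ Z := le_trans (le_max_left _ _) hZ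
  have hZ2r : (2 : ℝ) ≤ Z := by exact_mod_cast hZ2
  have hZ1r : (1 : ℝ) ≤ Z := by linarith
  have hZ0r : (0 : ℝ) < Z := by linarith
  have hCZ : 2 * C ^ 4 < (Z : ℝ) := lt_of_lt_of_le hN (by exact_mod_cast hNZ)
  have hv1 : (1 : ℝ) ≤ v := by exact_mod_cast hv
  have hw1 : (1 : ℝ) ≤ w := by exact_mod_cast hw
  have hY1 : (1 : ℝ) ≤ Y := by exact_mod_cast hY
  have hZη1 : (1 : ℝ) ≤ (Z : ℝ) ^ η := Real.one_le_rpow hZ1r hη0.le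
  have hZηZ : (Z : ℝ) ^ η ≤ Z := by
    calc (Z : ℝ) ^ η ≤ (Z : ℝ) ^ (1 : ℝ) := Real.rpow_le_rpow_of_exponent_le hZ1r hη1
      _ = Z := Real.rpow_one _
  have hvr : (v : ℝ) ≤ (Z : ℝ) ^ η := le_trans (by exact_mod_cast le_max_left v w) hmax
  have hwr : (w : ℝ) ≤ (Z : ℝ) ^ η := le_trans (by exact_mod_cast le_max_right v w) hmax
  -- the nonzero integer `D = wZ⁴ − vY⁴`
  obtain ⟨Dz, hDz⟩ : ∃ Dz : ℤ, Dz = (w : ℤ) * (Z : ℤ) ^ 4 - (v : ℤ) * (Y : ℤ) ^ 4 := ⟨_, rfl⟩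
  have hcast : ((w * Z ^ 4 : ℕ) : ℝ) - ((v * Y ^ 4 : ℕ) : ℝ) = (Dz : ℝ) := by
    rw [hDz]
    push_cast
    ring
  have hDzR : (Dz : ℝ) = (w : ℝ) * (Z : ℝ) ^ 4 - (v : ℝ) * (Y : ℝ) ^ 4 := by
    rw [hDz]
    push_cast
    ring
  have hDz0 : Dz ≠ 0 := by
    intro h
    apply hne
    have h' : ((w * Z ^ 4 : ℕ) : ℤ) = ((v * Y ^ 4 : ℕ) : ℤ) := by
      push_cast
      linear_combination h - hDz
    exact_mod_cast h'
  have hDz1 : (1 : ℝ) ≤ |(Dz : ℝ)| := by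
    rw [← Int.cast_abs]
    exact_mod_cast Int.one_le_abs hDz0
  rw [hcast] at hcon
  -- `gcd(v, w) = 1`
  have hvw : Nat.Coprime v w := (hcop.coprime_mul_right).coprime_mul_right_right
  by_cases hsq : IsSquare (v * w)
  · -- CASE A: `v = s²`, `w = t²`; factorisation
    obtain ⟨⟨s, hs⟩, ⟨t, ht⟩⟩ := ulGivesUBQ_isSquare_of_coprime hvw hsq
    have hs0 : 0 < s := Nat.pos_of_ne_zero (fun h => by simp [h] at hs; omega)
    have ht0 : 0 < t := Nat.pos_of_ne_zero (fun h => by simp [h] at ht; omega)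
    have hDz' : Dz = (t : ℤ) * t * (Z : ℤ) ^ 4 - (s : ℤ) * s * (Y : ℤ) ^ 4 := by
      rw [hDz, hs, ht]
      push_cast
      ring
    have hcorner : (Z : ℤ) ^ 2 + 1 ≤ |Dz| := by
      rw [hDz']
      exact ulGivesUBQ_square_corner _ _ _ _ (by exact_mod_cast hs0) (by exact_mod_cast ht0)
        (by exact_mod_cast hY) (by rw [← hDz']; exact hDz0)
    have hcornerR : (Z : ℝ) ^ 2 + 1 ≤ |(Dz : ℝ)| := by
      rw [← Int.cast_abs]
      exact_mod_cast hcorner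
    have hZsq : (Z : ℝ) ≤ (Z : ℝ) ^ 2 := by nlinarith
    linarith
  · -- CASE B: the dictionary `(d, k, x, y) = (vw, wD, wZ², Y)`
    have hd : ¬ IsSquare ((v * w : ℕ) : ℤ) := by rwa [Int.isSquare_natCast_iff]
    have hw0 : (w : ℤ) ≠ 0 := by exact_mod_cast hw.ne'
    have hk : (w : ℤ) * Dz ≠ 0 := mul_ne_zero hw0 hDz0
    have heq : ((w : ℤ) * (Z : ℤ) ^ 2) ^ 2 - ((v * w : ℕ) : ℤ) * (Y : ℤ) ^ 4 = (w : ℤ) * Dz := by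
      rw [hDz]
      push_cast
      ring
    -- the base `B = |d|·|k| = v·w·(w·|D|)`
    obtain ⟨B, hB⟩ : ∃ B : ℝ, B = (v : ℝ) * w * (w * |(Dz : ℝ)|) := ⟨_, rfl⟩
    have hyb : (Y : ℝ) ≤ C * B ^ K := by
      have h := hUL ((v * w : ℕ) : ℤ) ((w : ℤ) * Dz) ((w : ℤ) * (Z : ℤ) ^ 2) (Y : ℤ) hd hk heq
      have e1 : (|((Y : ℕ) : ℤ)| : ℝ) = (Y : ℝ) := by simp
      have e2 : ((|((v * w : ℕ) : ℤ)| * |(w : ℤ) * Dz| : ℤ) : ℝ) = B := by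
        rw [hB]
        push_cast
        rw [abs_mul, abs_mul, Nat.abs_cast, Nat.abs_cast]
      rw [e1, e2] at h
      exact h
    have hB1 : 1 ≤ B := by
      rw [hB]
      calc (1 : ℝ) = 1 * 1 * (1 * 1) := by ring
        _ ≤ (v : ℝ) * w * (w * |(Dz : ℝ)|) := by gcongr
    have hB0 : 0 ≤ B := le_trans zero_le_one hB1
    have hB4 : B ≤ (Z : ℝ) ^ (4 * η) := by
      have hpow : ((Z : ℝ) ^ η) ^ (4 : ℕ) = (Z : ℝ) ^ (4 * η) := by
        rw [← Real.rpow_natCast, ← Real.rpow_mul hZ0r.le]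
        congr 1
        push_cast
        ring
      calc B = (v : ℝ) * w * (w * |(Dz : ℝ)|) := hB
        _ ≤ (Z : ℝ) ^ η * (Z : ℝ) ^ η * ((Z : ℝ) ^ η * (Z : ℝ) ^ η) := by gcongr
        _ = ((Z : ℝ) ^ η) ^ (4 : ℕ) := by ring
        _ = (Z : ℝ) ^ (4 * η) := hpow
    -- `B^K ≤ Z^{4ηK₁}`, so `Y ≤ C·Z^{4ηK₁}` and `Y⁴ ≤ C⁴·Z^{16ηK₁}`
    have hBK : B ^ K ≤ (Z : ℝ) ^ (4 * η * K₁) := by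
      calc B ^ K ≤ B ^ K₁ := Real.rpow_le_rpow_of_exponent_le hB1 hKK₁
        _ ≤ ((Z : ℝ) ^ (4 * η)) ^ K₁ := Real.rpow_le_rpow hB0 hB4 hK₁0
        _ = (Z : ℝ) ^ (4 * η * K₁) := by rw [← Real.rpow_mul hZ0r.le]
    have hYle : (Y : ℝ) ≤ C * (Z : ℝ) ^ (4 * η * K₁) :=
      hyb.trans (mul_le_mul_of_nonneg_left hBK hC.le)
    have hY4 : (Y : ℝ) ^ 4 ≤ C ^ 4 * (Z : ℝ) ^ (16 * η * K₁) := by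
      have hpow : ((Z : ℝ) ^ (4 * η * K₁)) ^ (4 : ℕ) = (Z : ℝ) ^ (16 * η * K₁) := by
        rw [← Real.rpow_natCast, ← Real.rpow_mul hZ0r.le]
        congr 1
        push_cast
        ring
      calc (Y : ℝ) ^ 4 ≤ (C * (Z : ℝ) ^ (4 * η * K₁)) ^ 4 := pow_le_pow_left₀ (by positivity) hYle 4
        _ = C ^ 4 * ((Z : ℝ) ^ (4 * η * K₁)) ^ 4 := mul_pow _ _ _
        _ = C ^ 4 * (Z : ℝ) ^ (16 * η * K₁) := by rw [hpow]
    -- upper bound `vY⁴ ≤ C⁴·Z`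
    have hprod : (Z : ℝ) ^ η * (Z : ℝ) ^ (16 * η * K₁) = Z := by
      rw [← Real.rpow_add hZ0r]
      have hsum : η + 16 * η * K₁ = 1 := by linear_combination hηK
      rw [hsum, Real.rpow_one]
    have hup : (v : ℝ) * (Y : ℝ) ^ 4 ≤ C ^ 4 * Z := by
      calc (v : ℝ) * (Y : ℝ) ^ 4 ≤ (Z : ℝ) ^ η * (C ^ 4 * (Z : ℝ) ^ (16 * η * K₁)) :=
            mul_le_mul hvr hY4 (by positivity) (by positivity)
        _ = C ^ 4 * ((Z : ℝ) ^ η * (Z : ℝ) ^ (16 * η * K₁)) := by ring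
        _ = C ^ 4 * Z := by rw [hprod]
    -- lower bound `Z⁴ − Z ≤ wZ⁴ − D = vY⁴`
    have hDzle : (Dz : ℝ) ≤ Z := le_trans (le_abs_self _) (hcon.trans hZηZ)
    have hwZ : (Z : ℝ) ^ 4 ≤ (w : ℝ) * (Z : ℝ) ^ 4 := le_mul_of_one_le_left (by positivity) hw1
    have hlow : (Z : ℝ) ^ 4 - Z ≤ (v : ℝ) * (Y : ℝ) ^ 4 := by linarith
    -- contradiction: `Z⁴ − Z ≤ C⁴ Z < Z²/2`, but `Z ≥ 2`
    exact ulGivesUBQ_absurd hZ2r hCZ hlow hup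

/-- Stub 1 of line `SketchIdeator5`, registered form: UNIFORM LJUNGGREN (every integer solution of
`x² − d y⁴ = k`, `d` non-square, `k ≠ 0`, has `|y| ≤ C (|d||k|)^K`) implies a uniform power saving
`|wZ⁴ − vY⁴| > Z^η` for the binomial quartic family, for some `η > 0`. -/
theorem stub_ulGivesUBQ : (∃ K C : ℝ, 0 < C ∧ ∀ d k x y : ℤ, ¬ IsSquare d → k ≠ 0 → x ^ 2 - d * y ^ 4 = k → (|y| : ℝ) ≤ C * ((|d| * |k| : ℤ) : ℝ) ^ K) → ∃ η : ℝ, 0 < η ∧ ∃ Z₀ : ℕ, ∀ v w Y Z : ℕ, Z₀ ≤ Z → 0 < v → 0 < w → 0 < Y → Nat.Coprime (v * Y) (w * Z) → ((max v w : ℕ) : ℝ) ≤ (Z : ℝ) ^ η → w * Z ^ 4 ≠ v * Y ^ 4 → (Z : ℝ) ^ η < |((w * Z ^ 4 : ℕ) : ℝ) - ((v * Y ^ 4 : ℕ) : ℝ)| :=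
  fun ⟨_, _, hC, hUL⟩ => ulGivesUBQ_core hC hUL

end Summit.ABC.ABC.Theorems.TowerFourSubLiouville
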